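import Summits.QuantumFields.YangMills.Theorems.BalabanUVNodesN18StepMatchedLetter

/-!
# BalabanUVNodes ∕ N18 — THE STEP-MATCHED N18 LETTER, KERNEL ∕ RECORD ∕ PIN EDITION: the letter in def-W1's kernel currency (`kernelA g k` vs `kernelA (prependCoupling b g) (k+1)`
# at the STEP-MATCHED pairs only), at node U3's bundle `u3OfRecord₁₃ θ (objects F ℰ ρ bV ℓ) k`, at the kernels of record `objectsOfRecord₁₃`, and UNDER K3's READING PIN
# `(𝔯.lit …).u3 = objectsOfRecord₁₃ …` — (D4) `ReadOutAt` + the kernel letter of record ⟹ `ShiftAlongRun` for the datum's β (the `hU2` road's input) and, with the recovering selector,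
# the N19′ rate edge's `h18` at the pinned bundle; K3's current box conjunct `N18At` is STRONGER (by name); plus the STRICTNESS TOY (a first-entry-only, transport-consistent family
# where the step-matched letter holds with constant 0 and the box letter fails for every `C₅`, `θ < 1`)
# (Track A, DAG node N18 = NE5; key K3⁸ `SpineGivenEndpointR13SepCoPHV` = stmt-QuantumFields-27366, skeleton v6 b4e55110ab73e679; width seat `pub-ymgap-dag-n18-w1` g7, FILE 2 — record edition of
# FILE 1 `…N18StepMatchedLetter`; pattern of g6 FILE 4 `…N18RunWindowEdgeRecord` p632519)

HONEST FRAMING.  Count-neutral kernel bookkeeping BY NAME (`--kind proof --supports stmt-QuantumFields-27366 --as helper`): FILE 1's theorems instantiated at def-W1's kernel carrier (faces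
`rfl`, FILE 3-g6's `ne5At_EA_EB_iff_kernel`), at W1-19's `objectsOfRecord₁₃` and under the reading pin (g2's `n18At_rateCarriers_of_kernels_pin_iff_letter` for the comparison with K3's
box conjunct); §6 is an explicit toy over ABSTRACT carriers (no Bałaban object).  The kernel step-matched letter (N18's η-rate asked only at the pairs `(b; g)` with `g 0` the
(0.20)-successor of `b` — NE5 NOT PRINTED for d = 4), the (D4) binder `ReadOutAt`, the window-stability of the runs and the level-0 β-side binders are DISPLAYED HYPOTHESES; nothing of
Bałaban's is asserted, inhabited, discharged or refuted; N17 ∕ N18 NOT discharged; K3⁸ OPEN (v6), no stub proved ∕ refuted, NO skeleton re-keyed (R-N18-SEL remains a located input);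
K3⁷ 20544 aside.  Counts UNMOVED (typed 28∕28 · discharged 5∕27, A 5∕28).  One finite four-torus programme at fixed `ε`, Bałaban AS PRINTED; route R4 closes ONLY the conditional
finite-𝕋⁴ rung `BalabanLadder.UV` — NOT the continuum limit, NOT ℝ⁴, NOT OS, NOT the Yang–Mills mass gap, NOT Clay.  THEOREMS ONLY: 0 `def`, 0 `instance`, 0 `sorry`, standard axioms.

WHAT (theorems only).  §4 def-W1 kernels (generic `ℰ`): `kernelStepMatched_iff_stepMatched_carriers` (kernel form ⟺ FILE 1's carrier form at `carriers ∕ EA ∕ EB ∕ Window γ`) ·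
`kernelStepMatched_of_kernelStepRate` (W1-21's box letter ⟹ it) · `stepMatched_u3OfRecord₁₃_objects_iff_kernel` (at the bundle, faces `rfl`) · ★★ `shiftAlongRun_of_readOutAt_objects_kernelStepMatched`
· ★★ `shiftAlongRun_of_readOutAt_objectsOfRecord₁₃_kernelStepMatched` · `kernelStepMatchedOfRecord_of_kernelStepRateOfRecord₁₃`.  §5 under the pin: ★★
`shiftAlongRun_of_readOutAt_pin_kernelStepMatched` · `shiftAlongRun_runFlow_of_readOutAt_pin_kernelStepMatched` (run `K+1` of a tuned sequence) · `kernelStepMatchedOfRecord_of_n18At_pin`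
(K3's current conjunct is STRONGER) · ★ `ne5_selector_of_kernelStepMatched_pin` (the N19′ `h18` at the pinned bundle from the kernel letter + a recovering selector).  §5b from K3's
OWN binders: `continuousOn_of_lipschitz₀` · ★★ `exists_selector_ne5_recovers_of_readOutAt_n22At` ((D4) `ReadOutAt D u` + `N22At u` supply `D.βfun`'s level-0 modulus
`u.cr·u.Λ 1 0 ≤ u.cr·u.C₉·u.ω` by `T4BetaReadOutLipschitz.histLipschitz_of_ne9_on`; + the letter + level-0 sign ∕ bound + regime `u.cr·u.C₉·u.ω·u.γ³ < 2` ⟹ `hbsel` ∧ `h18` ∧ recovery).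
§6 the strictness toy: `toy_stepMatched` · `toy_not_boxLetter`.

References (TYPES ∕ locators only): [Balaban1987RG1] CMP **109** (1987): (0.18)–(0.20) pp. 255–256, Thm 1 ∕ 2 p. 259, (1.20)–(1.22) p. 264, §5 p. 298.
-/

noncomputable section

namespace YMDAG.N18.StepMatchedLetter

open Literature.MathematicalPhysics.QuantumFieldTheory.Balaban1983to89
open Literature.MathematicalPhysics.QuantumFieldTheory.Balaban1983to89.T4Continuum (T4Family ULoop)
open Literature.MathematicalPhysics.QuantumFieldTheory.Balaban1983to89.FlowStep (Box HBeta mem_box prefixOf prefixOf_apply RGEqH BetaUpperH)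
open Literature.MathematicalPhysics.QuantumFieldTheory.Balaban1983to89.T4TwoRunUniqueness (rgEqH_of_tuned)
open Literature.MathematicalPhysics.QuantumFieldTheory.Balaban1983to89.T4OutputRate (Carriers Functional Window NE5 mem_window)
open Literature.MathematicalPhysics.QuantumFieldTheory.Balaban1983to89.Node00 (TermFamily1 prependCoupling U3Letters₁₁ Stage13Params Stage13HParams)
open Literature.MathematicalPhysics.QuantumFieldTheory.Balaban1983to89.Node00.U3OfKernels (kernelA EA EB pt carriers objects objectsOfRecord₁₃)
open Literature.MathematicalPhysics.QuantumFieldTheory.Balaban1983to89.Node00.U3KernelLetters (KernelStepRate KernelStepRateOfRecord₁₃)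
open Literature.MathematicalPhysics.QuantumFieldTheory.Balaban1983to89.B12Sec2to5 (l1)
open Summit.QuantumFields.BalabanUV.T4Continuum.NE7MarginalL1Currency (ShiftAlongRun)
open Summit.QuantumFields.BalabanUV.T4Continuum.Spine.NE4 (runFlow box_and_pin_of_tuned)
open YMDAG.N18.RunWindowEdge (ne5At_EA_EB_iff_kernel)
open YMDAG.N18.AtRecordOfKernelLetters (n18At_u3OfRecord₁₃_objects_iff_kernelStepRate_letter n18At_rateCarriers_of_kernels_pin_iff_letter)
open YMDAG.UVSplit

/-! ## §4 def-W1's kernels (generic term family): the KERNEL STEP-MATCHED LETTER; at the bundle `u3OfRecord₁₃ θ (objects F ℰ ρ bV ℓ) k`; at the kernels of record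

THE KERNEL STEP-MATCHED LETTER at `(ℰ, β, γ, κ, θ, C₅)` (spelled inline): `∀ b ∈ ]0,γ], ∀ g ∈ ]0,γ]^ℕ, 1∕b² = 1∕(g 0)² + β 0 (b) → ∀ k μ ν z, |Π_{k+1}(g; z) − Π_{k+2}(b, g; z)| ≤
C₅θ^{k+1}e^{−κ|z|₁}` — W1-21's `KernelStepRate` with the free first coupling `b` tied to `g 0` by the first (0.20) step. -/

section Kernels

open scoped Matrix.Norms.L2Operator

variable {𝔄 : Type*} [NormedRing 𝔄] [NormedAlgebra ℝ 𝔄]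
variable {V : Type*} [NormedAddCommGroup V] [NormedSpace ℝ V] {ι : Type*} [Fintype ι]
variable (F : T4Family) (ℰ : TermFamily1 F 𝔄) (ρ : V →L[ℝ] 𝔄) (bV : Module.Basis ι ℝ V)

/-- **KERNEL FORM ⟺ CARRIER FORM**: the kernel step-matched letter IS FILE 1's step-matched letter at def-W1's kernel carrier `carriers` with the functionals `EA ∕ EB` and the window
`]0,γ]^ℕ` (pointwise in `(b, g)` by g6 FILE 3's `ne5At_EA_EB_iff_kernel`). [cite: Balaban1987RG1, (1.21) p.264 and Thm 1 p.259 (dictionary)] -/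
theorem kernelStepMatched_iff_stepMatched_carriers (β : HBeta) (γ κ θ C₅ : ℝ) :
    (∀ b, 0 < b → b ≤ γ → ∀ g ∈ Window γ, 1 / b ^ 2 = 1 / (g 0) ^ 2 + β 0 (fun _ => b) → ∀ (k : ℕ) (μ ν : Fin 4) (z : Fin 4 → ℤ),
        |kernelA F ℰ ρ bV g k μ ν z - kernelA F ℰ ρ bV (prependCoupling b g) (k + 1) μ ν z| ≤ C₅ * θ ^ (k + 1) * Real.exp (-(κ * l1 z))) ↔
      ∀ b, 0 < b → b ≤ γ → ∀ s ∈ Window γ, 1 / b ^ 2 = 1 / (s 0) ^ 2 + β 0 (fun _ => b) →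
        ∀ (U : carriers.BgB) (X : carriers.Dom),
          |EA F ℰ ρ bV s (carriers.transport U) X - EB F ℰ ρ bV b s U X| ≤ C₅ * θ ^ carriers.scale X * Real.exp (-(κ * carriers.d X)) :=
  forall₃_congr fun b _ _ => forall₂_congr fun g _ => forall_congr' fun _ => (ne5At_EA_EB_iff_kernel F ℰ ρ bV b g κ θ C₅).symm

/-- W1-21's BOX letter `KernelStepRate F ℰ ρ bV γ κ θ C₅` (free first coupling) implies the kernel step-matched letter for EVERY β (drop the matching condition).
[cite: Balaban1987RG1, Thm 1 p.259 and (1.21) p.264] -/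
theorem kernelStepMatched_of_kernelStepRate {γ κ θ C₅ : ℝ} (h18 : KernelStepRate F ℰ ρ bV γ κ θ C₅) (β : HBeta) :
    ∀ b, 0 < b → b ≤ γ → ∀ g ∈ Window γ, 1 / b ^ 2 = 1 / (g 0) ^ 2 + β 0 (fun _ => b) → ∀ (k : ℕ) (μ ν : Fin 4) (z : Fin 4 → ℤ),
      |kernelA F ℰ ρ bV g k μ ν z - kernelA F ℰ ρ bV (prependCoupling b g) (k + 1) μ ν z| ≤ C₅ * θ ^ (k + 1) * Real.exp (-(κ * l1 z)) :=
  fun b hb hbγ g hg _ k μ ν z => h18 b hb hbγ g hg k μ ν z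

variable {N : ℕ} [NeZero N]

/-- **AT THE BUNDLE `u3OfRecord₁₃ θ (objects F ℰ ρ bV ℓ) kk`** (dag-n17-a ∕ n22's bundle of record at def-W1's objects; faces `rfl`: `W = ]0,θ.γ]^ℕ`, `γ = θ.γ`, `EA ∕ EB` the kernel
functionals, letters `ℓ.κ ∕ ℓ.θ₅ ∕ ℓ.C₅`): FILE 1's step-matched letter at the bundle ⟺ the kernel step-matched letter with the bundle's letters.
[cite: Balaban1987RG1, (1.21) p.264 and Thm 1 p.259 (dictionary)] -/
theorem stepMatched_u3OfRecord₁₃_objects_iff_kernel (θ : Stage13Params F N) (ℓ : U3Letters₁₁) (kk : ℕ) (β : HBeta) :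
    (∀ b, 0 < b → b ≤ (u3OfRecord₁₃ θ (objects F ℰ ρ bV ℓ) kk).γ → ∀ s ∈ (u3OfRecord₁₃ θ (objects F ℰ ρ bV ℓ) kk).W,
        1 / b ^ 2 = 1 / (s 0) ^ 2 + β 0 (fun _ => b) →
        ∀ (U : (u3OfRecord₁₃ θ (objects F ℰ ρ bV ℓ) kk).C.BgB) (X : (u3OfRecord₁₃ θ (objects F ℰ ρ bV ℓ) kk).C.Dom),
          |(u3OfRecord₁₃ θ (objects F ℰ ρ bV ℓ) kk).EA s ((u3OfRecord₁₃ θ (objects F ℰ ρ bV ℓ) kk).C.transport U) X -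
              (u3OfRecord₁₃ θ (objects F ℰ ρ bV ℓ) kk).EB b s U X| ≤
            (u3OfRecord₁₃ θ (objects F ℰ ρ bV ℓ) kk).C₅ * (u3OfRecord₁₃ θ (objects F ℰ ρ bV ℓ) kk).θ ^ (u3OfRecord₁₃ θ (objects F ℰ ρ bV ℓ) kk).C.scale X *
              Real.exp (-((u3OfRecord₁₃ θ (objects F ℰ ρ bV ℓ) kk).κ * (u3OfRecord₁₃ θ (objects F ℰ ρ bV ℓ) kk).C.d X))) ↔
      ∀ b, 0 < b → b ≤ θ.γ → ∀ g ∈ Window θ.γ, 1 / b ^ 2 = 1 / (g 0) ^ 2 + β 0 (fun _ => b) → ∀ (k : ℕ) (μ ν : Fin 4) (z : Fin 4 → ℤ),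
        |kernelA F ℰ ρ bV g k μ ν z - kernelA F ℰ ρ bV (prependCoupling b g) (k + 1) μ ν z| ≤ ℓ.C₅ * ℓ.θ₅ ^ (k + 1) * Real.exp (-(ℓ.κ * l1 z)) :=
  (kernelStepMatched_iff_stepMatched_carriers F ℰ ρ bV β θ.γ ℓ.κ ℓ.θ₅ ℓ.C₅).symm

/-- ★★ **AT THE BUNDLE: (D4) + THE KERNEL STEP-MATCHED LETTER FOR THE DATUM's β ⟹ NE4 ALONG THE PREFIXES OF EVERY IN-WINDOW RUN** — `ReadOutAt D (u3OfRecord₁₃ θ (objects F ℰ ρ bV ℓ) kk)`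
(the (D4) binder K3's rates predicate carries) and N18's η-rate asked ONLY at the step-matched pairs `(b; g)` of `]0,θ.γ] × ]0,θ.γ]^ℕ` give, for every sequence `g^B` in `]0,θ.γ]` up to
`K+1` obeying (0.20) of `D.βfun` at its first step, `ShiftAlongRun (fun j ↦ ℓ.cr·ℓ.C₅·ℓ.θ₅·ℓ.θ₅^j) D.βfun g^B K` (FILE 1 `shiftAlongRun_of_readOutAt_stepMatched`; faces `rfl`).
[cite: Balaban1987RG1, (0.18)–(0.20) pp.255–256, (1.20)–(1.22) p.264, Thm 1 p.259] -/
theorem shiftAlongRun_of_readOutAt_objects_kernelStepMatched (θ : Stage13Params F N) (ℓ : U3Letters₁₁) (kk : ℕ) (D : Datum F N)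
    (hD4 : ReadOutAt D (u3OfRecord₁₃ θ (objects F ℰ ρ bV ℓ) kk))
    (h18sm : ∀ b, 0 < b → b ≤ θ.γ → ∀ g ∈ Window θ.γ, 1 / b ^ 2 = 1 / (g 0) ^ 2 + D.βfun 0 (fun _ => b) → ∀ (k : ℕ) (μ ν : Fin 4) (z : Fin 4 → ℤ),
      |kernelA F ℰ ρ bV g k μ ν z - kernelA F ℰ ρ bV (prependCoupling b g) (k + 1) μ ν z| ≤ ℓ.C₅ * ℓ.θ₅ ^ (k + 1) * Real.exp (-(ℓ.κ * l1 z)))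
    {K : ℕ} {gB : ℕ → ℝ} (hstep0 : 1 / (gB 0) ^ 2 = 1 / (gB 1) ^ 2 + D.βfun 0 (fun _ => gB 0)) (hbox : ∀ i, i ≤ K + 1 → 0 < gB i ∧ gB i ≤ θ.γ) :
    ShiftAlongRun (fun j => ℓ.cr * ℓ.C₅ * ℓ.θ₅ * ℓ.θ₅ ^ j) D.βfun gB K :=
  shiftAlongRun_of_readOutAt_stepMatched D hD4 ((stepMatched_u3OfRecord₁₃_objects_iff_kernel F ℰ ρ bV θ ℓ kk D.βfun).2 h18sm) hstep0 hbox

variable (N)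

/-- ★★ **AT THE KERNELS OF RECORD** `objectsOfRecord₁₃ F N θ ℓ` (W1-19): (D4) at the bundle of record + THE KERNEL STEP-MATCHED LETTER OF RECORD (stated through the objects' run-A functional,
`(objectsOfRecord₁₃ …).EA 0 g · (pt k μ ν z) = Π_{k+1}(g; μν z)` of the merged term of record; the prepended table `prependCoupling b g` read one level up is run B's member at `b`) ⟹
`ShiftAlongRun (ℓ.cr·ℓ.C₅·ℓ.θ₅·ℓ.θ₅^·) D.βfun g^B K` along every such run. [cite: Balaban1987RG1, (0.18)–(0.20) pp.255–256, (1.20)–(1.22) p.264, Thm 1 p.259] -/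
theorem shiftAlongRun_of_readOutAt_objectsOfRecord₁₃_kernelStepMatched (θ : Stage13Params F N) (ℓ : U3Letters₁₁) (kk : ℕ) (D : Datum F N)
    (hD4 : ReadOutAt D (u3OfRecord₁₃ θ (objectsOfRecord₁₃ F N θ ℓ) kk))
    (h18sm : ∀ b, 0 < b → b ≤ θ.γ → ∀ g ∈ Window θ.γ, 1 / b ^ 2 = 1 / (g 0) ^ 2 + D.βfun 0 (fun _ => b) → ∀ (k : ℕ) (μ ν : Fin 4) (z : Fin 4 → ℤ),
      |(objectsOfRecord₁₃ F N θ ℓ).EA 0 g PUnit.unit (pt k μ ν z) - (objectsOfRecord₁₃ F N θ ℓ).EA 0 (prependCoupling b g) PUnit.unit (pt (k + 1) μ ν z)| ≤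
        ℓ.C₅ * ℓ.θ₅ ^ (k + 1) * Real.exp (-(ℓ.κ * l1 z)))
    {K : ℕ} {gB : ℕ → ℝ} (hstep0 : 1 / (gB 0) ^ 2 = 1 / (gB 1) ^ 2 + D.βfun 0 (fun _ => gB 0)) (hbox : ∀ i, i ≤ K + 1 → 0 < gB i ∧ gB i ≤ θ.γ) :
    ShiftAlongRun (fun j => ℓ.cr * ℓ.C₅ * ℓ.θ₅ * ℓ.θ₅ ^ j) D.βfun gB K := by
  letI := θ.instVβ₁; letI := θ.instVβ₂; letI := θ.instιβ
  have hD4' : ReadOutAt D (u3OfRecord₁₃ θ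
      (objects F (Node00.mergedTermFamilyMatT F N (Node00.TβOfRecord₁₃ F N) (Node00.chiβOfRecord₁₃ F N θ) θ.εbg) θ.ρ8 θ.bV ℓ) kk) := hD4
  have h18' : ∀ b, 0 < b → b ≤ θ.γ → ∀ g ∈ Window θ.γ, 1 / b ^ 2 = 1 / (g 0) ^ 2 + D.βfun 0 (fun _ => b) → ∀ (k : ℕ) (μ ν : Fin 4) (z : Fin 4 → ℤ),
      |kernelA F (Node00.mergedTermFamilyMatT F N (Node00.TβOfRecord₁₃ F N) (Node00.chiβOfRecord₁₃ F N θ) θ.εbg) θ.ρ8 θ.bV g k μ ν z -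
          kernelA F (Node00.mergedTermFamilyMatT F N (Node00.TβOfRecord₁₃ F N) (Node00.chiβOfRecord₁₃ F N θ) θ.εbg) θ.ρ8 θ.bV (prependCoupling b g) (k + 1) μ ν z| ≤
        ℓ.C₅ * ℓ.θ₅ ^ (k + 1) * Real.exp (-(ℓ.κ * l1 z)) :=
    fun b hb hbγ g hg hm k μ ν z => h18sm b hb hbγ g hg hm k μ ν z
  exact shiftAlongRun_of_readOutAt_objects_kernelStepMatched F _ θ.ρ8 θ.bV θ ℓ kk D hD4' h18' hstep0 hbox

/-- At the record, today's BOX letter of record `KernelStepRateOfRecord₁₃ F N θ ℓ.κ ℓ.θ₅ ℓ.C₅` (W1-19b) ⟹ the kernel step-matched letter of record for EVERY β (the letter R-N18-SEL names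
is WEAKER than today's). [cite: Balaban1987RG1, Thm 1 p.259 and (1.21) p.264] -/
theorem kernelStepMatchedOfRecord_of_kernelStepRateOfRecord₁₃ (θ : Stage13Params F N) (ℓ : U3Letters₁₁) (β : HBeta)
    (h18 : KernelStepRateOfRecord₁₃ F N θ ℓ.κ ℓ.θ₅ ℓ.C₅) :
    ∀ b, 0 < b → b ≤ θ.γ → ∀ g ∈ Window θ.γ, 1 / b ^ 2 = 1 / (g 0) ^ 2 + β 0 (fun _ => b) → ∀ (k : ℕ) (μ ν : Fin 4) (z : Fin 4 → ℤ),
      |(objectsOfRecord₁₃ F N θ ℓ).EA 0 g PUnit.unit (pt k μ ν z) - (objectsOfRecord₁₃ F N θ ℓ).EA 0 (prependCoupling b g) PUnit.unit (pt (k + 1) μ ν z)| ≤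
        ℓ.C₅ * ℓ.θ₅ ^ (k + 1) * Real.exp (-(ℓ.κ * l1 z)) := by
  letI := θ.instVβ₁; letI := θ.instVβ₂; letI := θ.instιβ
  have h := kernelStepMatched_of_kernelStepRate F
    (Node00.mergedTermFamilyMatT F N (Node00.TβOfRecord₁₃ F N) (Node00.chiβOfRecord₁₃ F N θ) θ.εbg) θ.ρ8 θ.bV h18 β
  exact fun b hb hbγ g hg hm k μ ν z => h b hb hbγ g hg hm k μ ν z

end Kernels

/-! ## §5 Under K3's reading pin `(𝔯.lit F θ hP g₀ os).u3 = objectsOfRecord₁₃ F N θ ℓ` (the `U3PinnedKernels` clause at one tuple): the N18 ∕ (D4) carriers of the rates predicate -/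

section Pin

open scoped Matrix.Norms.L2Operator

variable (F : T4Family) {N : ℕ} [NeZero N]

/-- ★★ **UNDER THE PIN: (D4) AT THE BUNDLE OF RECORD + THE KERNEL STEP-MATCHED LETTER OF RECORD ⟹ NE4 ALONG THE PREFIXES OF EVERY IN-WINDOW RUN OF THE DATUM's β.**  With `hpin`,
the (D4) binder `ReadOutAt D (rateCarriersOfRecord₁₃CoPH 𝔯 F θ hP g₀ os k).u3` — literally the read-out conjunct of K3's rates predicate at the bundle of record — and N18's η-rate at the
step-matched pairs through the kernels of record give `ShiftAlongRun (ℓ.cr·ℓ.C₅·ℓ.θ₅·ℓ.θ₅^·) D.βfun g^B K` for every `g^B` in `]0,θ.γ]` up to `K+1` obeying (0.20) at its first step — WITHOUT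
the box conjunct `N18At`. [cite: Balaban1987RG1, (0.18)–(0.20) pp.255–256, (1.20)–(1.22) p.264, Thm 1 p.259] -/
theorem shiftAlongRun_of_readOutAt_pin_kernelStepMatched (𝔯 : RateReading₁₃CoPH N) (θ : Stage13HParams F N) (hP : θ.Provisos₁₃CoPH F N)
    (g₀ : ℕ → ℝ) (os : List (ULoop F)) (ℓ : U3Letters₁₁) (hpin : (𝔯.lit F θ hP g₀ os).u3 = objectsOfRecord₁₃ F N θ.toStage13Params ℓ) (kk : ℕ) (D : Datum F N)
    (hD4 : ReadOutAt D (rateCarriersOfRecord₁₃CoPH 𝔯 F θ hP g₀ os kk).u3)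
    (h18sm : ∀ b, 0 < b → b ≤ θ.γ → ∀ g ∈ Window θ.γ, 1 / b ^ 2 = 1 / (g 0) ^ 2 + D.βfun 0 (fun _ => b) → ∀ (k : ℕ) (μ ν : Fin 4) (z : Fin 4 → ℤ),
      |(objectsOfRecord₁₃ F N θ.toStage13Params ℓ).EA 0 g PUnit.unit (pt k μ ν z) -
          (objectsOfRecord₁₃ F N θ.toStage13Params ℓ).EA 0 (prependCoupling b g) PUnit.unit (pt (k + 1) μ ν z)| ≤ ℓ.C₅ * ℓ.θ₅ ^ (k + 1) * Real.exp (-(ℓ.κ * l1 z)))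
    {K : ℕ} {gB : ℕ → ℝ} (hstep0 : 1 / (gB 0) ^ 2 = 1 / (gB 1) ^ 2 + D.βfun 0 (fun _ => gB 0)) (hbox : ∀ i, i ≤ K + 1 → 0 < gB i ∧ gB i ≤ θ.γ) :
    ShiftAlongRun (fun j => ℓ.cr * ℓ.C₅ * ℓ.θ₅ * ℓ.θ₅ ^ j) D.βfun gB K := by
  have hD4' : ReadOutAt D (u3OfRecord₁₃ θ.toStage13Params (objectsOfRecord₁₃ F N θ.toStage13Params ℓ) kk) := by
    have e : (rateCarriersOfRecord₁₃CoPH 𝔯 F θ hP g₀ os kk).u3 = u3OfRecord₁₃ θ.toStage13Params (𝔯.lit F θ hP g₀ os).u3 kk := rfl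
    rw [e, hpin] at hD4
    exact hD4
  exact shiftAlongRun_of_readOutAt_objectsOfRecord₁₃_kernelStepMatched F N θ.toStage13Params ℓ kk D hD4' h18sm hstep0 hbox

/-- **… ALONG RUN `K+1` OF A TUNED SEQUENCE** (`g₀` tuned to `g` within `]0,θ.γ]`, [Balaban1987RG1] Thm 2 p. 259; `BetaUpperH β′ θ.γ D.βfun` with `θ.γ²β′ < 1` only to run (0.20) forward,
`rgEqH_of_tuned`): under the pin, (D4) + the kernel step-matched letter of record ⟹ `ShiftAlongRun (ℓ.cr·ℓ.C₅·ℓ.θ₅·ℓ.θ₅^·) D.βfun (runFlow D g₀ (K+1)) K` for EVERY `K` — the input `hS` of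
`Spine/NE4/Necessity.u2Output_of_ne4AlongRuns` at `c = ℓ.cr·ℓ.C₅·ℓ.θ₅`, `θ = ℓ.θ₅`. [cite: Balaban1987RG1, (0.20) p.256 and Thm 2 p.259] -/
theorem shiftAlongRun_runFlow_of_readOutAt_pin_kernelStepMatched (𝔯 : RateReading₁₃CoPH N) (θ : Stage13HParams F N) (hP : θ.Provisos₁₃CoPH F N)
    (g₀ : ℕ → ℝ) (os : List (ULoop F)) (ℓ : U3Letters₁₁) (hpin : (𝔯.lit F θ hP g₀ os).u3 = objectsOfRecord₁₃ F N θ.toStage13Params ℓ) (kk : ℕ) (D : Datum F N)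
    (hD4 : ReadOutAt D (rateCarriersOfRecord₁₃CoPH 𝔯 F θ hP g₀ os kk).u3)
    (h18sm : ∀ b, 0 < b → b ≤ θ.γ → ∀ g ∈ Window θ.γ, 1 / b ^ 2 = 1 / (g 0) ^ 2 + D.βfun 0 (fun _ => b) → ∀ (k : ℕ) (μ ν : Fin 4) (z : Fin 4 → ℤ),
      |(objectsOfRecord₁₃ F N θ.toStage13Params ℓ).EA 0 g PUnit.unit (pt k μ ν z) -
          (objectsOfRecord₁₃ F N θ.toStage13Params ℓ).EA 0 (prependCoupling b g) PUnit.unit (pt (k + 1) μ ν z)| ≤ ℓ.C₅ * ℓ.θ₅ ^ (k + 1) * Real.exp (-(ℓ.κ * l1 z)))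
    {β' gt : ℝ} {gt₀ : ℕ → ℝ} (hγ : 0 < θ.γ) (hhi : BetaUpperH β' θ.γ D.βfun) (hγβ : θ.γ ^ 2 * β' < 1) (ht : D.Tuned θ.γ gt gt₀) (K : ℕ) :
    ShiftAlongRun (fun j => ℓ.cr * ℓ.C₅ * ℓ.θ₅ * ℓ.θ₅ ^ j) D.βfun (runFlow D gt₀ (K + 1)) K := by
  obtain ⟨hbox, -⟩ := box_and_pin_of_tuned D ht
  have hrun : RGEqH (K + 1) D.βfun (runFlow D gt₀ (K + 1)) := rgEqH_of_tuned D hhi hγβ hγ le_rfl ht (K + 1)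
  have hstep0 := hrun 0 (Nat.succ_pos K)
  rw [prefixOf_zero_eq_const] at hstep0
  exact shiftAlongRun_of_readOutAt_pin_kernelStepMatched F 𝔯 θ hP g₀ os ℓ hpin kk D hD4 h18sm (by simpa using hstep0) (hbox (K + 1))

/-- **K3's CURRENT N18 CONJUNCT AT THE PINNED BUNDLE IS STRONGER**: `N18At (rateCarriersOfRecord₁₃CoPH 𝔯 F θ hP g₀ os k).u3` (⟺ `KernelStepRateOfRecord₁₃`, g2's
`n18At_rateCarriers_of_kernels_pin_iff_letter`) ⟹ the kernel step-matched letter of record for EVERY β.  So re-keying N18 per R-N18-SEL only WEAKENS what stub 1's witness must supply.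
[cite: Balaban1987RG1, Thm 1 p.259 and (1.21) p.264] -/
theorem kernelStepMatchedOfRecord_of_n18At_pin (𝔯 : RateReading₁₃CoPH N) (θ : Stage13HParams F N) (hP : θ.Provisos₁₃CoPH F N) (g₀ : ℕ → ℝ) (os : List (ULoop F))
    (ℓ : U3Letters₁₁) (hpin : (𝔯.lit F θ hP g₀ os).u3 = objectsOfRecord₁₃ F N θ.toStage13Params ℓ) (kk : ℕ) (β : HBeta)
    (h18 : N18At (rateCarriersOfRecord₁₃CoPH 𝔯 F θ hP g₀ os kk).u3) :
    ∀ b, 0 < b → b ≤ θ.γ → ∀ g ∈ Window θ.γ, 1 / b ^ 2 = 1 / (g 0) ^ 2 + β 0 (fun _ => b) → ∀ (k : ℕ) (μ ν : Fin 4) (z : Fin 4 → ℤ),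
      |(objectsOfRecord₁₃ F N θ.toStage13Params ℓ).EA 0 g PUnit.unit (pt k μ ν z) -
          (objectsOfRecord₁₃ F N θ.toStage13Params ℓ).EA 0 (prependCoupling b g) PUnit.unit (pt (k + 1) μ ν z)| ≤ ℓ.C₅ * ℓ.θ₅ ^ (k + 1) * Real.exp (-(ℓ.κ * l1 z)) :=
  kernelStepMatchedOfRecord_of_kernelStepRateOfRecord₁₃ F N θ.toStage13Params ℓ β ((n18At_rateCarriers_of_kernels_pin_iff_letter F 𝔯 θ hP g₀ os ℓ hpin kk).1 h18)

/-- ★ **THE N19′ RATE EDGE's `h18` AT THE PINNED BUNDLE FROM THE KERNEL LETTER + A RECOVERING SELECTOR**: under `hpin`, the kernel step-matched letter of record for `β` and a selector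
`bsel` returning on `]0,θ.γ]^ℕ` a step-matched first coupling in `]0,θ.γ]` (FILE 1 §1: it exists hypothesis-free where predecessors exist, and recovers run heads under first-step
injectivity) give `NE5 R.u3.EA (fun s ↦ R.u3.EB (bsel s) s) R.u3.W R.u3.κ R.u3.θ R.u3.C₅` at `R := rateCarriersOfRecord₁₃CoPH 𝔯 F θ hP g₀ os k` — what `…N19RateEdge.rateEdge_of_linkReading`
consumes of N18 at that bundle. [cite: Balaban1987RG1, Thm 1 p.259, (1.21) p.264, (0.20) p.256] -/
theorem ne5_selector_of_kernelStepMatched_pin (𝔯 : RateReading₁₃CoPH N) (θ : Stage13HParams F N) (hP : θ.Provisos₁₃CoPH F N) (g₀ : ℕ → ℝ) (os : List (ULoop F))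
    (ℓ : U3Letters₁₁) (hpin : (𝔯.lit F θ hP g₀ os).u3 = objectsOfRecord₁₃ F N θ.toStage13Params ℓ) (kk : ℕ) (β : HBeta)
    (h18sm : ∀ b, 0 < b → b ≤ θ.γ → ∀ g ∈ Window θ.γ, 1 / b ^ 2 = 1 / (g 0) ^ 2 + β 0 (fun _ => b) → ∀ (k : ℕ) (μ ν : Fin 4) (z : Fin 4 → ℤ),
      |(objectsOfRecord₁₃ F N θ.toStage13Params ℓ).EA 0 g PUnit.unit (pt k μ ν z) -
          (objectsOfRecord₁₃ F N θ.toStage13Params ℓ).EA 0 (prependCoupling b g) PUnit.unit (pt (k + 1) μ ν z)| ≤ ℓ.C₅ * ℓ.θ₅ ^ (k + 1) * Real.exp (-(ℓ.κ * l1 z)))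
    {bsel : (ℕ → ℝ) → ℝ} (hbsel : ∀ s ∈ Window θ.γ, 0 < bsel s ∧ bsel s ≤ θ.γ ∧ 1 / (bsel s) ^ 2 = 1 / (s 0) ^ 2 + β 0 (fun _ => bsel s)) :
    NE5 (rateCarriersOfRecord₁₃CoPH 𝔯 F θ hP g₀ os kk).u3.EA (fun s => (rateCarriersOfRecord₁₃CoPH 𝔯 F θ hP g₀ os kk).u3.EB (bsel s) s)
      (rateCarriersOfRecord₁₃CoPH 𝔯 F θ hP g₀ os kk).u3.W (rateCarriersOfRecord₁₃CoPH 𝔯 F θ hP g₀ os kk).u3.κ (rateCarriersOfRecord₁₃CoPH 𝔯 F θ hP g₀ os kk).u3.θ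
      (rateCarriersOfRecord₁₃CoPH 𝔯 F θ hP g₀ os kk).u3.C₅ := by
  have e : (rateCarriersOfRecord₁₃CoPH 𝔯 F θ hP g₀ os kk).u3 = u3OfRecord₁₃ θ.toStage13Params (objectsOfRecord₁₃ F N θ.toStage13Params ℓ) kk := by
    show u3OfRecord₁₃ θ.toStage13Params (𝔯.lit F θ hP g₀ os).u3 kk = _
    rw [hpin]
  rw [e]
  letI := θ.instVβ₁; letI := θ.instVβ₂; letI := θ.instιβ
  refine ne5_selector_of_stepMatched_carriers
    ((stepMatched_u3OfRecord₁₃_objects_iff_kernel F _ θ.ρ8 θ.bV θ.toStage13Params ℓ kk β).2 fun b hb hbγ g hg hm k μ ν z => h18sm b hb hbγ g hg hm k μ ν z) hbsel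

end Pin

/-! ## §5b The N19′ link reading's N18-side obligations FROM K3's OWN BINDERS: (D4) `ReadOutAt` + N22 supply the level-0 modulus (`T4BetaReadOutLipschitz.histLipschitz_of_ne9_on`) -/

section FromN22

variable {F : T4Family} {N : ℕ} [NeZero N]

/-- A Lipschitz modulus on `]0,γ]` makes the first β-function continuous there (so §1's intermediate-value argument applies). [folklore] -/
theorem continuousOn_of_lipschitz₀ {β : HBeta} {γ Λ₀ : ℝ}
    (hLip : ∀ b b', 0 < b → b ≤ γ → 0 < b' → b' ≤ γ → |β 0 (fun _ => b) - β 0 (fun _ => b')| ≤ Λ₀ * |b - b'|) :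
    ContinuousOn (fun b : ℝ => β 0 (fun _ => b)) (Set.Ioc 0 γ) := by
  refine Metric.continuousOn_iff.mpr fun b hb ε hε => ⟨ε / (|Λ₀| + 1), by positivity, fun a ha hab => ?_⟩
  rw [Real.dist_eq] at hab ⊢
  have hL1 : 0 < |Λ₀| + 1 := by positivity
  have h1 := hLip a b ha.1 ha.2 hb.1 hb.2
  have h2 : Λ₀ * |a - b| ≤ |Λ₀| * |a - b| := mul_le_mul_of_nonneg_right (le_abs_self Λ₀) (abs_nonneg _)
  have h3 : |Λ₀| * |a - b| ≤ |Λ₀| * (ε / (|Λ₀| + 1)) := mul_le_mul_of_nonneg_left hab.le (abs_nonneg Λ₀)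
  have h4 : |Λ₀| * (ε / (|Λ₀| + 1)) < ε := by
    rw [mul_div_assoc', div_lt_iff₀ hL1]
    nlinarith [abs_nonneg Λ₀]
  linarith

/-- ★★ **ALL THREE N18-SIDE OBLIGATIONS OF THE N19′ LINK READING FROM K3's (D4) + N22 + THE STEP-MATCHED LETTER.**  At carriers `u` with `u.W ⊆ Window u.γ`: `ReadOutAt D u` (the read-out
binders) and `N22At u` (kernel NE9 + fading memory) give `D.βfun` the history moduli `u.cr·u.Λ (k+1) i` (`T4BetaReadOutLipschitz.histLipschitz_of_ne9_on` BY NAME), hence a level-0 modulus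
`Λ₀ = u.cr·u.Λ 1 0 ≤ u.cr·u.C₉·u.ω` and the continuity of `β₁`; add the step-matched letter for `D.βfun`, the DISPLAYED level-0 sign and bound of `β₁` and the DISPLAYED regime
`u.cr·u.C₉·u.ω·u.γ³ < 2` ⟹ a selector with (i) `hbsel`, (ii) `h18 : NE5 u.EA (fun s ↦ u.EB (bsel s) s) u.W …`, (iii) first-coupling recovery along every run of (0.20) of `D.βfun`.
[cite: Balaban1987RG1, (0.20) p.256, §1 pp.263–264, (1.20)–(1.22) p.264, §5 p.298] -/
theorem exists_selector_ne5_recovers_of_readOutAt_n22At (D : Datum F N) {u : U3Carriers} (hD4 : ReadOutAt D u) (h22 : N22At u)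
    (hSM : ∀ b, 0 < b → b ≤ u.γ → ∀ s ∈ u.W, 1 / b ^ 2 = 1 / (s 0) ^ 2 + D.βfun 0 (fun _ => b) →
      ∀ (U : u.C.BgB) (X : u.C.Dom), |u.EA s (u.C.transport U) X - u.EB b s U X| ≤ u.C₅ * u.θ ^ u.C.scale X * Real.exp (-(u.κ * u.C.d X)))
    (hWγ : u.W ⊆ Window u.γ) {β' : ℝ}
    (hsign : ∀ b, 0 < b → b ≤ u.γ → 0 ≤ D.βfun 0 (fun _ => b)) (hup : ∀ b, 0 < b → b ≤ u.γ → D.βfun 0 (fun _ => b) ≤ β')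
    (hsmall : u.cr * u.C₉ * u.ω * u.γ ^ 3 < 2) :
    ∃ bsel : (ℕ → ℝ) → ℝ,
      (∀ s ∈ u.W, 0 < bsel s ∧ bsel s ≤ u.γ) ∧
      NE5 u.EA (fun s => u.EB (bsel s) s) u.W u.κ u.θ u.C₅ ∧
      (∀ (n : ℕ) (gs : ℕ → ℝ), RGEqH n D.βfun gs → 1 ≤ n → 0 < gs 0 ∧ gs 0 ≤ u.γ → bsel (fun i => gs (i + 1)) = gs 0) := by
  obtain ⟨𝒜A, 𝒜B, rA, rB, hW, hA, -, h𝒜A, -, hr, -, hcr, -⟩ := hD4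
  have hL := T4BetaReadOutLipschitz.histLipschitz_of_ne9_on hW h22.1 hA h𝒜A hr
  have hLip := lipschitz₀_of_histLipschitz hL
  have hΛnn : 0 ≤ u.Λ 1 0 := (h22.2 1 0 (Nat.zero_le 1)).1
  have hΛ10 : u.Λ 1 0 ≤ u.C₉ * u.ω := by simpa using (h22.2 1 0 (Nat.zero_le 1)).2
  -- the displayed regime gives `Λ₀γ³ < 2` for the level-0 modulus `Λ₀ = u.cr·u.Λ 1 0`
  have hsmall' : u.cr * u.Λ (0 + 1) 0 * u.γ ^ 3 < 2 := by
    show u.cr * u.Λ 1 0 * u.γ ^ 3 < 2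
    rcases le_or_gt u.γ 0 with hγ | hγ
    · have hγ3 : u.γ ^ 3 ≤ 0 := by rw [pow_succ]; exact mul_nonpos_of_nonneg_of_nonpos (sq_nonneg _) hγ
      have : u.cr * u.Λ 1 0 * u.γ ^ 3 ≤ 0 := mul_nonpos_of_nonneg_of_nonpos (mul_nonneg hcr hΛnn) hγ3
      linarith
    · have h1 : u.cr * u.Λ 1 0 ≤ u.cr * (u.C₉ * u.ω) := mul_le_mul_of_nonneg_left hΛ10 hcr
      have h2 := mul_le_mul_of_nonneg_right h1 (pow_nonneg hγ.le 3)
      linarith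
  exact exists_selector_ne5_recovers_carriers hSM hWγ (continuousOn_of_lipschitz₀ hLip) hsign hup hLip hsmall'

end FromN22

/-! ## §6 THE STRICTNESS TOY (abstract carriers): a first-entry-only, transport-consistent family — the step-matched letter holds with constant 0, the box letter fails for every `C₅`, `θ < 1`

Carriers: domains `ℕ` (scale = the level, tree length 0), one-point backgrounds, identity transport; run A reads `EA s X = 1∕(s 0)² − X·c`, run B's member at first coupling `b` reads
`EB b s X = 1∕b² − (X+1)·c` (first-entry-only, and consistent with the Markovian β ≡ `c`: one more RG step from `b` costs exactly `c`).  At a step-matched pair `1∕b² = 1∕(s 0)² + c`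
the two agree IDENTICALLY; at the independent pairs the box letter would force `|1∕(s 0)² + c − 1∕b²| ≤ C₅θ^X → 0`, false at `b = s 0` when `c ≠ 0`. -/

section Toy

/-- The toy carriers: levels as domains, one-point backgrounds, identity transport. [folklore] -/
theorem toy_stepMatched (c γ κ : ℝ) :
    let C : Carriers := ⟨ℕ, id, fun _ => 0, fun _ => le_rfl, PUnit, PUnit, fun _ _ => 0, fun _ _ => le_rfl, id⟩
    let EA : Functional C C.BgA := fun s _ X => 1 / (s 0) ^ 2 - (X : ℝ) * c
    let EB : ℝ → Functional C C.BgB := fun b _ _ X => 1 / b ^ 2 - ((X : ℝ) + 1) * c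
    ∀ b, 0 < b → b ≤ γ → ∀ s ∈ Window γ, 1 / b ^ 2 = 1 / (s 0) ^ 2 + (fun _ _ => c : HBeta) 0 (fun _ => b) →
      ∀ (U : C.BgB) (X : C.Dom), |EA s (C.transport U) X - EB b s U X| ≤ 0 * (1 / 2 : ℝ) ^ C.scale X * Real.exp (-(κ * C.d X)) := by
  intro C EA EB b _ _ s _ hm U X
  have h : EA s (C.transport U) X - EB b s U X = 0 := by
    show 1 / (s 0) ^ 2 - (X : ℝ) * c - (1 / b ^ 2 - ((X : ℝ) + 1) * c) = 0
    rw [hm]; ring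
  rw [h, abs_zero, zero_mul, zero_mul]

/-- **… WHILE THE BOX LETTER FAILS THERE** for every constant `C₅` and every ratio `0 ≤ θ < 1`, as soon as `c ≠ 0` and `γ > 0`: at the independent pair `b = s 0 = γ` the box letter
asks `|c| ≤ C₅θ^X` for all levels `X`, impossible.  So FILE 1's `stepMatched_of_boxLetter` is STRICT, and the step-matched keying survives a first-entry-only degeneration that kills
the box keying (g6 FILE 1 ∕ 2's shadow, here at abstract carriers). [folklore] -/
theorem toy_not_boxLetter {c γ θ : ℝ} (hc : c ≠ 0) (hγ : 0 < γ) (hθ0 : 0 ≤ θ) (hθ1 : θ < 1) (κ C₅ : ℝ) :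
    let C : Carriers := ⟨ℕ, id, fun _ => 0, fun _ => le_rfl, PUnit, PUnit, fun _ _ => 0, fun _ _ => le_rfl, id⟩
    let EA : Functional C C.BgA := fun s _ X => 1 / (s 0) ^ 2 - (X : ℝ) * c
    let EB : ℝ → Functional C C.BgB := fun b _ _ X => 1 / b ^ 2 - ((X : ℝ) + 1) * c
    ¬ ∀ b, 0 < b → b ≤ γ → NE5 EA (EB b) (Window γ) κ θ C₅ := by
  intro C EA EB h
  have hs : (fun _ : ℕ => γ) ∈ Window γ := mem_window.mpr fun _ => ⟨hγ, le_rfl⟩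
  -- at the independent pair `b = s 0 = γ` the difference is `c` at every level
  have key : ∀ X : ℕ, |c| ≤ C₅ * θ ^ X := by
    intro X
    have hX := h γ hγ le_rfl (fun _ => γ) hs PUnit.unit X
    have e : EA (fun _ => γ) (C.transport PUnit.unit) X - EB γ (fun _ => γ) PUnit.unit X = c := by
      show 1 / γ ^ 2 - (X : ℝ) * c - (1 / γ ^ 2 - ((X : ℝ) + 1) * c) = c
      ring
    have hd : Real.exp (-(κ * C.d X)) = 1 := by show Real.exp (-(κ * 0)) = 1; simp
    rw [e, hd, mul_one] at hX
    exact hX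
  -- `C₅θ^X → 0`, contradiction with `|c| > 0`
  have hlim : Filter.Tendsto (fun X : ℕ => C₅ * θ ^ X) Filter.atTop (nhds 0) := by
    simpa using (tendsto_pow_atTop_nhds_zero_of_lt_one hθ0 hθ1).const_mul C₅
  have hpos : 0 < |c| := abs_pos.mpr hc
  obtain ⟨X, hX⟩ := (hlim.eventually (gt_mem_nhds hpos)).exists
  exact absurd (key X) (not_le.mpr hX)

end Toy

end YMDAG.N18.StepMatchedLetter

end
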